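import Literature.Algebra.Homology.SplitComplexField
import Literature.Algebra.Homology.KunnethMapIso
import Mathlib.Algebra.Homology.BifunctorHomotopy
import HarnessLib

/-!
# The Künneth isomorphism over a field for UNBOUNDED complexes (Weibel Thm. 3.6.3)

Layer `Literature/Algebra/Homology` (pure homological algebra over Mathlib; two constructions + proved lemmas, 0 named facts, no
instances, no notation). `Algebra/Homology/KunnethMapIso.isIso_kunnethMap` proves that the Künneth map
`κₙ : ∐_{i+j=n} Hⁱ(C) ⊗ Hʲ(D) ⟶ Hⁿ(C ⊗ D)` is an isomorphism for BOUNDED complexes of vector spaces (it transports along the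
quasi-isomorphisms `C ⟶ (H•(C), 0)`, and «tensoring preserves quasi-isomorphisms» was available only under boundedness —
the `TODO(general form)` recorded in `KunnethField.lean` / `KunnethMapIso.lean`). Over a field those quasi-isomorphisms are part
of HOMOTOPY EQUIVALENCES (`Algebra/Homology/SplitComplexField.homotopyEquivHomologyOfField`), and homotopies survive tensoring
(Mathlib `mapBifunctorMapHomotopy₁/₂`), so no boundedness is needed:

* `tensorHomotopy` — homotopies `f ~ f'`, `g ~ g'` give `f ⊗ g ~ f' ⊗ g'`; `tensorHomotopyEquiv e₁ e₂ : C₁ ⊗ D₁ ≃ₕ C₂ ⊗ D₂`;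
* **`isIso_kunnethMap_of_field C D n`** — for ANY cochain complexes `C`, `D` of `k`-vector spaces, `κₙ` is an isomorphism;
  **`kunnethIsoOfField C D n : ∐_{i+j=n} Hⁱ(C) ⊗ Hʲ(D) ≅ Hⁿ(C ⊗ D)`**, `ι_kunnethIsoOfField_hom` (its components are the
  `kunnethComponent`s `[z] ⊗ [w] ↦ [z ⊗ w]`).

Nothing in the accepted files `KunnethMapIso.lean` / `KunnethField.lean` is edited; their bounded statements remain and this file
supersedes the `TODO(general form)` there (the Künneth SHORT EXACT SEQUENCE with `Tor₁` over a PID is still not formalised). Library only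
(cell `pub-hodge-ring2`, count-neutral); proves nothing about any crux, route or conjecture. Mathlib searched (pin v4.32):
`HomologicalComplex.mapBifunctorMapHomotopy₁` / `₂`, `Homotopy.trans` / `ofEq`, `HomotopyEquiv.quasiIso_hom` (used).

## References

* C. A. Weibel, *An introduction to homological algebra* (1994), Thm. 3.6.3, 2.7.1. [Weibel1994]
* H. Cartan, S. Eilenberg, *Homological Algebra* (1956), VI.3, Thm. 3.1. [CartanEilenberg1956]
-/

noncomputable section

-- `GradedObject`/`HomologicalComplex₂.toGradedObject` are not reducible (as in Mathlib's `Algebra/Homology/TotalComplex.lean`).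
set_option backward.isDefEq.respectTransparency false

open CategoryTheory CategoryTheory.Category CategoryTheory.Limits CategoryTheory.MonoidalCategory HomologicalComplex

universe u

namespace Literature.Algebra.Homology

/-! ### §1 Tensor products of homotopies and of homotopy equivalences -/

section Tensor

variable {R : Type u} [CommRing R]

/-- Functoriality of `tensorHom` (composition). [cite: Weibel1994, 2.7.1] -/
private theorem tensorHom_comp_tensorHom_unb {C₁ C₂ C₃ D₁ D₂ D₃ : CochainComplex (ModuleCat.{u} R) ℤ} (f₁ : C₁ ⟶ C₂)
    (f₂ : C₂ ⟶ C₃) (g₁ : D₁ ⟶ D₂) (g₂ : D₂ ⟶ D₃) :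
    HomologicalComplex.tensorHom f₁ g₁ ≫ HomologicalComplex.tensorHom f₂ g₂ =
      HomologicalComplex.tensorHom (f₁ ≫ f₂) (g₁ ≫ g₂) := by
  refine HomologicalComplex.hom_ext _ _ fun n => mapBifunctor.hom_ext fun i j hij => ?_
  rw [comp_f, ι_mapBifunctorMap_assoc, ι_mapBifunctorMap, ι_mapBifunctorMap]
  change (f₁.f i ▷ _) ≫ (_ ◁ g₁.f j) ≫ (f₂.f i ▷ _) ≫ (_ ◁ g₂.f j) ≫ _ =
    ((f₁.f i ≫ f₂.f i) ▷ _) ≫ (_ ◁ (g₁.f j ≫ g₂.f j)) ≫ _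
  rw [← tensorHom_def_assoc, ← tensorHom_def_assoc, ← tensorHom_def_assoc, tensorHom_comp_tensorHom_assoc]

/-- `tensorHom` of the identities is the identity. [cite: Weibel1994, 2.7.1] -/
private theorem tensorHom_id_id_unb (C₁ D₁ : CochainComplex (ModuleCat.{u} R) ℤ) :
    HomologicalComplex.tensorHom (𝟙 C₁) (𝟙 D₁) = 𝟙 _ := by
  refine HomologicalComplex.hom_ext _ _ fun n => mapBifunctor.hom_ext fun i j hij => ?_
  rw [ι_mapBifunctorMap, id_f, id_f, id_f, comp_id, CategoryTheory.Functor.map_id, NatTrans.id_app,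
    CategoryTheory.Functor.map_id, id_comp, id_comp]

/-- `tensorHom` of two isomorphisms is an isomorphism. [cite: Weibel1994, 2.7.1] -/
private theorem isIso_tensorHom_unb {C₁ C₂ D₁ D₂ : CochainComplex (ModuleCat.{u} R) ℤ} (φ : C₁ ⟶ C₂) (ψ : D₁ ⟶ D₂)
    [IsIso φ] [IsIso ψ] : IsIso (HomologicalComplex.tensorHom φ ψ) :=
  ⟨HomologicalComplex.tensorHom (inv φ) (inv ψ), by rw [tensorHom_comp_tensorHom_unb, IsIso.hom_inv_id,
    IsIso.hom_inv_id, tensorHom_id_id_unb], by rw [tensorHom_comp_tensorHom_unb, IsIso.inv_hom_id, IsIso.inv_hom_id,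
    tensorHom_id_id_unb]⟩

/-- **Homotopies survive tensoring**: `f ~ f'` and `g ~ g'` give `f ⊗ g ~ f' ⊗ g'` (Mathlib's `mapBifunctorMapHomotopy₁` then `₂`).
[cite: Weibel1994, 2.7.1] -/
def tensorHomotopy {C₁ C₂ D₁ D₂ : CochainComplex (ModuleCat.{u} R) ℤ} {f f' : C₁ ⟶ C₂} {g g' : D₁ ⟶ D₂} (h₁ : Homotopy f f')
    (h₂ : Homotopy g g') : Homotopy (HomologicalComplex.tensorHom f g) (HomologicalComplex.tensorHom f' g') :=
  (mapBifunctorMapHomotopy₁ h₁ g (curriedTensor (ModuleCat.{u} R)) (ComplexShape.up ℤ)).trans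
    (mapBifunctorMapHomotopy₂ f' h₂ (curriedTensor (ModuleCat.{u} R)) (ComplexShape.up ℤ))

/-- **The tensor product of two homotopy equivalences is a homotopy equivalence.** [cite: Weibel1994, 2.7.1] -/
def tensorHomotopyEquiv {C₁ C₂ D₁ D₂ : CochainComplex (ModuleCat.{u} R) ℤ} (e₁ : HomotopyEquiv C₁ C₂) (e₂ : HomotopyEquiv D₁ D₂) :
    HomotopyEquiv (HomologicalComplex.tensorObj C₁ D₁) (HomologicalComplex.tensorObj C₂ D₂) where
  hom := HomologicalComplex.tensorHom e₁.hom e₂.hom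
  inv := HomologicalComplex.tensorHom e₁.inv e₂.inv
  homotopyHomInvId := (Homotopy.ofEq (tensorHom_comp_tensorHom_unb _ _ _ _)).trans
    ((tensorHomotopy e₁.homotopyHomInvId e₂.homotopyHomInvId).trans (Homotopy.ofEq (tensorHom_id_id_unb _ _)))
  homotopyInvHomId := (Homotopy.ofEq (tensorHom_comp_tensorHom_unb _ _ _ _)).trans
    ((tensorHomotopy e₁.homotopyInvHomId e₂.homotopyInvHomId).trans (Homotopy.ofEq (tensorHom_id_id_unb _ _)))

end Tensor

/-! ### §2 The Künneth isomorphism over a field, no boundedness -/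

section Field

variable {k : Type u} [Field k] (C D : CochainComplex (ModuleCat.{u} k) ℤ)

/-- **`C ⊗ D ⟶ (H•(C), 0) ⊗ (H•(D), 0)` is a quasi-isomorphism** for ANY complexes of vector spaces: it is the forward map of
the tensor product of the homotopy equivalences `homotopyEquivHomologyOfField`. [cite: Weibel1994, Thm. 3.6.3 (proof)] -/
theorem quasiIso_tensorHom_homotopyEquivHomologyOfField :
    QuasiIso (HomologicalComplex.tensorHom (homotopyEquivHomologyOfField C).hom (homotopyEquivHomologyOfField D).hom) :=
  (tensorHomotopyEquiv (homotopyEquivHomologyOfField C) (homotopyEquivHomologyOfField D)).quasiIso_hom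

/-- **The Künneth theorem over a field, canonical form, UNBOUNDED complexes** (Weibel Thm. 3.6.3; Cartan–Eilenberg VI.3.1): for
any cochain complexes `C`, `D` of `k`-vector spaces the Künneth map `κₙ : ∐_{i+j=n} Hⁱ(C) ⊗ Hʲ(D) ⟶ Hⁿ(C ⊗ D)` is an isomorphism.
[cite: Weibel1994, Thm. 3.6.3] [cite: CartanEilenberg1956, VI.3 Thm. 3.1] -/
theorem isIso_kunnethMap_of_field (n : ℤ) : IsIso (kunnethMap C D n) := by
  let ρC := (homotopyEquivHomologyOfField C).hom
  let ρD := (homotopyEquivHomologyOfField D).hom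
  haveI : QuasiIso ρC := (homotopyEquivHomologyOfField C).quasiIso_hom
  haveI : QuasiIso ρD := (homotopyEquivHomologyOfField D).quasiIso_hom
  -- `Hⁿ(ρ_C ⊗ ρ_D)` is an isomorphism
  haveI := quasiIso_tensorHom_homotopyEquivHomologyOfField C D
  haveI : IsIso (homologyMap (HomologicalComplex.tensorHom ρC ρD) n) := by
    rw [← quasiIsoAt_iff_isIso_homologyMap]; infer_instance
  -- `((H(ρ_C),0) ⊗ (H(ρ_D),0))ⁿ` is an isomorphism
  haveI := isIso_homologyZeroDifferentialMap ρC
  haveI := isIso_homologyZeroDifferentialMap ρD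
  haveI := isIso_tensorHom_unb (homologyZeroDifferentialMap ρC) (homologyZeroDifferentialMap ρD)
  -- the Künneth map of the zero-differential complexes is an isomorphism
  haveI := isIso_kunnethMap_of_d_eq_zero (homologyZeroDifferential C) (homologyZeroDifferential D)
    (fun _ _ => rfl) (fun _ _ => rfl) n
  have hnat := kunnethMap_naturality ρC ρD n
  haveI : IsIso (kunnethMap C D n ≫ homologyMap (HomologicalComplex.tensorHom ρC ρD) n) := by
    rw [hnat]; infer_instance
  exact IsIso.of_isIso_comp_right (kunnethMap C D n) (homologyMap (HomologicalComplex.tensorHom ρC ρD) n)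

/-- **The Künneth isomorphism `∐_{i+j=n} Hⁱ(C) ⊗ Hʲ(D) ≅ Hⁿ(C ⊗ D)`** over a field, for arbitrary (unbounded) cochain complexes.
[cite: Weibel1994, Thm. 3.6.3] [cite: CartanEilenberg1956, VI.3 Thm. 3.1] -/
def kunnethIsoOfField (n : ℤ) :
    (HomologicalComplex.tensorObj (homologyZeroDifferential C) (homologyZeroDifferential D)).X n ≅
      (HomologicalComplex.tensorObj C D).homology n :=
  haveI := isIso_kunnethMap_of_field C D n
  asIso (kunnethMap C D n)

/-- The unbounded Künneth isomorphism restricted to the summand `Hⁱ(C) ⊗ Hʲ(D)` is the component `κᵢⱼ`, `[z] ⊗ [w] ↦ [z ⊗ w]`.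
[cite: Weibel1994, Thm. 3.6.3] -/
theorem ι_kunnethIsoOfField_hom (i j n : ℤ) (h : i + j = n) :
    ιTensorObj (homologyZeroDifferential C) (homologyZeroDifferential D) i j n h ≫ (kunnethIsoOfField C D n).hom =
      kunnethComponent C D i j n h :=
  ι_kunnethMap C D i j n h

end Field

end Literature.Algebra.Homology

end
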